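import Summits.AtomisticToContinuum.Crystallization.Theorems.SquareWellLayerCakeStackingFaultSparsityLocalFramesLimitA

/-!
# Crux `StackingFaultSparsity` (stmt-AtomisticToContinuum-14296), line `Sketch` — stub `stub_localFrameLimit`, B

Limit infrastructure for the compactness step S0 (`stub_localFrameLimit`). The setting: a
`19/20`-separated set `X ⊆ ℝ³` (the local matching limit), a point `p ∈ X`, and normalised GOOD
windows (`lf_normalise`, part A) of configurations `w k : Fin (N k) → ℝ³` about particles `J k`
with `w k (J k) → p`, tolerances `δ k → 0`, frames `(a k, b k, n k, C k) → (al, bl, nl, cl)`,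
matched to `X` near `p` in both directions up to `δ k`. We prove:

* `lf_robust` — a tolerance `ε > 0` below which, among the finitely many points of `X` in
  `B̄(p, 3)`, distances `10ε`-close to `al` (or `bl`) are equal to it and heights `10ε`-close to a
  level `cl s`, `|s| ≤ 3`, are equal to it;
* `lf_late` — eventually in `k` the window is `ε`-late (tolerance, normal, lengths and the levels
  `|s| ≤ 3` are `ε`-close to their limits, and window particles near `p` are matched into `X`);
* `lf_lim_facts` — the limit frame inherits `al, bl ∈ [19/20, 1]`, `‖nl‖ = 1`, `cl 0 = 0`, gaps;
* `lf_label` — in a late window, a particle `j` within `2` of `J` that approximates `x ∈ X` has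
  label `|L j| ≤ 2` and `⟪x - p, nl⟫ = cl (L j)` EXACTLY;
* `lf_flat` — every `x ∈ X` with `dist x p < 2` has height `cl t` for some `t`;
* `lf_abs_level_one` — `|cl (±1)| ≥ 94/125`;
* `lf_cap_level`, `lf_cap_adjacent` — the laminar kissing caps in the limit: no `7` points of
  `X \ {p}` within `1` of `p` at height `0`, no `4` points of `X` within `1` of `p` at a common
  height `h` with `|h| ≥ 94/125` (`LaminarKissingCap.no_seven_level` / `no_four_adjacent`).
-/

noncomputable section

namespace Summit.AtomisticToContinuum.Crystallization.Theorems.SquareWellLayerCake.StackingFaultSparsity.LocalFrames.Limit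

open Filter Metric Topology

/-! ## A robust tolerance -/

/-- A robust tolerance at `p`: `ε ∈ (0, 1/100]` such that among the finitely many points of the
`19/20`-separated `X` in `B̄(p, 3)`, mutual distances `10ε`-close to `al` (resp. `bl`) equal `al`
(resp. `bl`), and heights `10ε`-close to a level `cl s` with `|s| ≤ 3` equal that level. -/
theorem lf_robust {X : Set (EuclideanSpace ℝ (Fin 3))}
    (hXsep : ∀ q ∈ X, ∀ r ∈ X, q ≠ r → (19 : ℝ) / 20 ≤ dist q r)
    (p : EuclideanSpace ℝ (Fin 3)) (al bl : ℝ) (nl : EuclideanSpace ℝ (Fin 3)) (cl : ℤ → ℝ) :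
    ∃ ε : ℝ, 0 < ε ∧ ε ≤ 1 / 100 ∧
      (∀ t ∈ X, ∀ t' ∈ X, dist t p ≤ 3 → dist t' p ≤ 3 →
        (|dist t t' - al| ≤ 10 * ε → dist t t' = al) ∧
        (|dist t t' - bl| ≤ 10 * ε → dist t t' = bl)) ∧
      (∀ t ∈ X, dist t p ≤ 3 → ∀ s : ℤ, -3 ≤ s → s ≤ 3 →
        |inner ℝ (t - p) nl - cl s| ≤ 10 * ε → inner ℝ (t - p) nl = cl s) := by
  have hT : (X ∩ closedBall p 3).Finite :=
    Literature.MathematicalPhysics.StatisticalMechanics.finite_of_forall_le_dist_of_subset_closedBall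
      (by norm_num : (0 : ℝ) < 19 / 20)
      (fun p hp q hq hpq => hXsep p hp.1 q hq.1 hpq) Set.inter_subset_right
  have hpos : ∀ᶠ ε in 𝓝[>] (0 : ℝ), ε ∈ Set.Ioi (0 : ℝ) := eventually_mem_nhdsWithin
  have hsmall : ∀ᶠ ε in 𝓝[>] (0 : ℝ), ε ≤ 1 / 100 :=
    (eventually_le_nhds (by norm_num : (0 : ℝ) < 1 / 100)).filter_mono nhdsWithin_le_nhds
  have hA := hT.eventually_all.2 fun t (_ : t ∈ X ∩ closedBall p 3) =>
    PeriodicWindowsSketch.gl_eventually_forall_eq_of_abs_sub_le hT (fun t' => dist t t') al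
  have hB := hT.eventually_all.2 fun t (_ : t ∈ X ∩ closedBall p 3) =>
    PeriodicWindowsSketch.gl_eventually_forall_eq_of_abs_sub_le hT (fun t' => dist t t') bl
  have hC := hT.eventually_all.2 fun t (_ : t ∈ X ∩ closedBall p 3) =>
    (Set.finite_Icc (-3 : ℤ) 3).eventually_all.2 fun s (_ : s ∈ Set.Icc (-3 : ℤ) 3) =>
      PeriodicWindowsSketch.gl_eventually_eq_of_abs_sub_le (inner ℝ (t - p) nl) (cl s)
  obtain ⟨ε, h0, h1, hA', hB', hC'⟩ := (hpos.and (hsmall.and (hA.and (hB.and hC)))).exists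
  refine ⟨ε, Set.mem_Ioi.1 h0, h1, fun t ht t' ht' htp ht'p => ?_, fun t ht htp s hs1 hs2 => ?_⟩
  · exact ⟨hA' t ⟨ht, mem_closedBall.2 htp⟩ t' ⟨ht', mem_closedBall.2 ht'p⟩,
      hB' t ⟨ht, mem_closedBall.2 htp⟩ t' ⟨ht', mem_closedBall.2 ht'p⟩⟩
  · exact hC' t ⟨ht, mem_closedBall.2 htp⟩ s ⟨hs1, hs2⟩

/-! ## Late windows -/

/-- **Lateness.** Eventually in `k`: the tolerance `δ k`, the normal, the lengths and the levels
`|s| ≤ 3` are `ε`-close to their limits, the centre particle is `δ k`-close to `p`, and every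
window particle within `4` of `p` is `δ k`-close to a point of `X`. -/
theorem lf_late {X : Set (EuclideanSpace ℝ (Fin 3))} {p : EuclideanSpace ℝ (Fin 3)} {N : ℕ → ℕ}
    {w : (k : ℕ) → Fin (N k) → EuclideanSpace ℝ (Fin 3)} {J : (k : ℕ) → Fin (N k)}
    {a b δ : ℕ → ℝ} {n : ℕ → EuclideanSpace ℝ (Fin 3)} {C : ℕ → ℤ → ℝ} {al bl : ℝ}
    {nl : EuclideanSpace ℝ (Fin 3)} {cl : ℤ → ℝ}
    (hJ : ∀ k, dist (w k (J k)) p ≤ δ k) (hδ : Tendsto δ atTop (𝓝 0))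
    (hM2 : ∀ R : ℝ, ∀ᶠ k in atTop, ∀ j, dist (w k j) p ≤ R → ∃ x ∈ X, dist (w k j) x ≤ δ k)
    (ha : Tendsto a atTop (𝓝 al)) (hb : Tendsto b atTop (𝓝 bl)) (hn : Tendsto n atTop (𝓝 nl))
    (hC : ∀ t, Tendsto (fun k => C k t) atTop (𝓝 (cl t))) {ε : ℝ} (hε : 0 < ε) :
    ∀ᶠ k in atTop, δ k ≤ ε ∧ ‖n k - nl‖ ≤ ε ∧ |a k - al| ≤ ε ∧ |b k - bl| ≤ ε ∧
      (∀ s : ℤ, -3 ≤ s → s ≤ 3 → |C k s - cl s| ≤ ε) ∧ dist (w k (J k)) p ≤ δ k ∧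
      ∀ j, dist (w k j) p ≤ 4 → ∃ x ∈ X, dist (w k j) x ≤ δ k := by
  have h1 : ∀ᶠ k in atTop, δ k ≤ ε := hδ.eventually (eventually_le_nhds hε)
  have h2 : ∀ᶠ k in atTop, ‖n k - nl‖ ≤ ε :=
    (tendsto_iff_norm_sub_tendsto_zero.1 hn).eventually (eventually_le_nhds hε)
  have h3 : ∀ᶠ k in atTop, |a k - al| ≤ ε := by
    filter_upwards [Metric.tendsto_nhds.1 ha ε hε] with k hk
    rw [← Real.dist_eq]
    exact hk.le
  have h4 : ∀ᶠ k in atTop, |b k - bl| ≤ ε := by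
    filter_upwards [Metric.tendsto_nhds.1 hb ε hε] with k hk
    rw [← Real.dist_eq]
    exact hk.le
  have h5 : ∀ᶠ k in atTop, ∀ s ∈ Set.Icc (-3 : ℤ) 3, |C k s - cl s| ≤ ε :=
    (Set.finite_Icc (-3 : ℤ) 3).eventually_all.2 fun s _ => by
      filter_upwards [Metric.tendsto_nhds.1 (hC s) ε hε] with k hk
      rw [← Real.dist_eq]
      exact hk.le
  filter_upwards [h1, h2, h3, h4, h5, hM2 4] with k hk1 hk2 hk3 hk4 hk5 hk6
  exact ⟨hk1, hk2, hk3, hk4, fun s hs1 hs2 => hk5 s ⟨hs1, hs2⟩, hJ k, hk6⟩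

/-- **Limit frame.** The limits inherit `al, bl ∈ [19/20, 1]`, `‖nl‖ = 1`, `cl 0 = 0` and the
level gaps `≥ 19/25` from the windows. -/
theorem lf_lim_facts {N : ℕ → ℕ} {w : (k : ℕ) → Fin (N k) → EuclideanSpace ℝ (Fin 3)}
    {J : (k : ℕ) → Fin (N k)} {a b δ : ℕ → ℝ} {n : ℕ → EuclideanSpace ℝ (Fin 3)}
    {C : ℕ → ℤ → ℝ} {L : (k : ℕ) → Fin (N k) → ℤ} {al bl : ℝ} {nl : EuclideanSpace ℝ (Fin 3)}
    {cl : ℤ → ℝ}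
    (hW : ∀ k, 19 / 20 ≤ a k ∧ a k ≤ 1 ∧ 19 / 20 ≤ b k ∧ b k ≤ 1 ∧ ‖n k‖ = 1 ∧ C k 0 = 0 ∧
      (∀ t : ℤ, C k t + 19 / 25 ≤ C k (t + 1)) ∧ L k (J k) = 0 ∧ 0 ≤ δ k ∧
      (∀ j : Fin (N k), dist (w k j) (w k (J k)) ≤ 2 →
        |inner ℝ (w k j - w k (J k)) (n k) - C k (L k j)| ≤ δ k) ∧
      (∀ j j' : Fin (N k), dist (w k j) (w k (J k)) ≤ 2 → dist (w k j') (w k (J k)) ≤ 2 →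
        j ≠ j' → 19 / 20 ≤ dist (w k j) (w k j')) ∧
      ∀ j : Fin (N k), dist (w k j) (w k (J k)) ≤ 1 →
        Nat.card {k' : Fin (N k) // k' ≠ j ∧ L k k' = L k j ∧ dist (w k j) (w k k') ≤ 1} = 6 ∧
        Nat.card {k' : Fin (N k) // L k k' = L k j + 1 ∧ dist (w k j) (w k k') ≤ 1} = 3 ∧
        Nat.card {k' : Fin (N k) // L k k' = L k j - 1 ∧ dist (w k j) (w k k') ≤ 1} = 3 ∧
        ∀ k' : Fin (N k), k' ≠ j → dist (w k j) (w k k') ≤ 1 →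
          (L k k' = L k j → |dist (w k j) (w k k') - a k| ≤ δ k) ∧
          (L k k' ≠ L k j → |dist (w k j) (w k k') - b k| ≤ δ k))
    (ha : Tendsto a atTop (𝓝 al)) (hb : Tendsto b atTop (𝓝 bl)) (hn : Tendsto n atTop (𝓝 nl))
    (hC : ∀ t, Tendsto (fun k => C k t) atTop (𝓝 (cl t))) :
    19 / 20 ≤ al ∧ al ≤ 1 ∧ 19 / 20 ≤ bl ∧ bl ≤ 1 ∧ ‖nl‖ = 1 ∧ cl 0 = 0 ∧
      ∀ t : ℤ, cl t + 19 / 25 ≤ cl (t + 1) := by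
  refine ⟨ge_of_tendsto' ha fun k => (hW k).1, le_of_tendsto' ha fun k => (hW k).2.1,
    ge_of_tendsto' hb fun k => (hW k).2.2.1, le_of_tendsto' hb fun k => (hW k).2.2.2.1,
    ?_, ?_, fun t => ?_⟩
  · have h := hn.norm
    have heq : (fun k => ‖n k‖) = fun _ => (1 : ℝ) := funext fun k => (hW k).2.2.2.2.1
    rw [heq] at h
    exact tendsto_nhds_unique h tendsto_const_nhds
  · have h := hC 0
    have heq : (fun k => C k 0) = fun _ => (0 : ℝ) := funext fun k => (hW k).2.2.2.2.2.1
    rw [heq] at h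
    exact tendsto_nhds_unique h tendsto_const_nhds
  · exact le_of_tendsto_of_tendsto' ((hC t).add_const (19 / 25)) (hC (t + 1))
      fun k => (hW k).2.2.2.2.2.2.1 t

/-! ## Labels of approximants -/

/-- **Label lemma.** In an `ε`-late window, a particle `j` within `2` of the centre particle `J`
that is `δ`-close to a point `x ∈ X` has label `|L j| ≤ 2`, and the height of `x` above `p` along
the limit normal is EXACTLY the limit level `cl (L j)` (robustness of the tolerance `ε`). -/
theorem lf_label {X : Set (EuclideanSpace ℝ (Fin 3))} {p : EuclideanSpace ℝ (Fin 3)} {N : ℕ}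
    {w : Fin N → EuclideanSpace ℝ (Fin 3)} {J : Fin N} {a b δ ε : ℝ}
    {n nl : EuclideanSpace ℝ (Fin 3)} {C cl : ℤ → ℝ} {L : Fin N → ℤ}
    (hW : 19 / 20 ≤ a ∧ a ≤ 1 ∧ 19 / 20 ≤ b ∧ b ≤ 1 ∧ ‖n‖ = 1 ∧ C 0 = 0 ∧
      (∀ t : ℤ, C t + 19 / 25 ≤ C (t + 1)) ∧ L J = 0 ∧ 0 ≤ δ ∧
      (∀ j : Fin N, dist (w j) (w J) ≤ 2 → |inner ℝ (w j - w J) n - C (L j)| ≤ δ) ∧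
      (∀ j j' : Fin N, dist (w j) (w J) ≤ 2 → dist (w j') (w J) ≤ 2 → j ≠ j' →
        19 / 20 ≤ dist (w j) (w j')) ∧
      ∀ j : Fin N, dist (w j) (w J) ≤ 1 →
        Nat.card {k : Fin N // k ≠ j ∧ L k = L j ∧ dist (w j) (w k) ≤ 1} = 6 ∧
        Nat.card {k : Fin N // L k = L j + 1 ∧ dist (w j) (w k) ≤ 1} = 3 ∧
        Nat.card {k : Fin N // L k = L j - 1 ∧ dist (w j) (w k) ≤ 1} = 3 ∧
        ∀ k : Fin N, k ≠ j → dist (w j) (w k) ≤ 1 →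
          (L k = L j → |dist (w j) (w k) - a| ≤ δ) ∧ (L k ≠ L j → |dist (w j) (w k) - b| ≤ δ))
    (hR2 : ∀ t ∈ X, dist t p ≤ 3 → ∀ s : ℤ, -3 ≤ s → s ≤ 3 →
      |inner ℝ (t - p) nl - cl s| ≤ 10 * ε → inner ℝ (t - p) nl = cl s)
    (hδε : δ ≤ ε) (hε : ε ≤ 1 / 100) (hnn : ‖n - nl‖ ≤ ε)
    (hCc : ∀ s : ℤ, -3 ≤ s → s ≤ 3 → |C s - cl s| ≤ ε) (hJp : dist (w J) p ≤ δ)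
    {x : EuclideanSpace ℝ (Fin 3)} (hx : x ∈ X) {j : Fin N} (hjx : dist (w j) x ≤ δ)
    (hjJ : dist (w j) (w J) ≤ 2) :
    -2 ≤ L j ∧ L j ≤ 2 ∧ inner ℝ (x - p) nl = cl (L j) := by
  obtain ⟨-, -, -, -, hn1, hC0, hCg, -, hδ0, hflat, -, -⟩ := hW
  have hf := hflat j hjJ
  have hin : |inner ℝ (w j - w J) n| ≤ 2 :=
    calc |inner ℝ (w j - w J) n| ≤ ‖w j - w J‖ * ‖n‖ := abs_real_inner_le_norm _ _
      _ ≤ 2 := by rw [hn1, mul_one, ← dist_eq_norm]; exact hjJ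
  have hb : |C (L j)| ≤ 56 / 25 := by
    have h1 := abs_le.1 hf
    have h2 := abs_le.1 hin
    rw [abs_le]
    constructor <;> linarith
  obtain ⟨hl1, hl2⟩ := lf_label_le_two hC0 hCg hb
  refine ⟨hl1, hl2, ?_⟩
  have hxp : dist x p ≤ 3 :=
    calc dist x p ≤ dist x (w j) + dist (w j) (w J) + dist (w J) p := dist_triangle4 _ _ _ _
      _ ≤ δ + 2 + δ := by rw [dist_comm]; gcongr
      _ ≤ 3 := by linarith
  have ht := lf_inner_transfer hn1 hjx hJp hnn
  have hxp' : ‖x - p‖ * ε ≤ 3 * ε := by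
    rw [← dist_eq_norm]
    exact mul_le_mul_of_nonneg_right hxp (by linarith)
  have hCc' := abs_le.1 (hCc (L j) (by omega) (by omega))
  refine hR2 x hx hxp (L j) (by omega) (by omega) ?_
  have h1 := abs_le.1 hf
  have h2 := abs_le.1 ht
  rw [abs_le]
  constructor <;> linarith

/-- **Flatness of the limit.** Every `x ∈ X` with `dist x p < 2` has height `cl t` above `p`
along `nl` for some level `t` (a late window, an approximant of `x`, and `lf_label`). -/
theorem lf_flat {X : Set (EuclideanSpace ℝ (Fin 3))} {p : EuclideanSpace ℝ (Fin 3)} {N : ℕ → ℕ}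
    {w : (k : ℕ) → Fin (N k) → EuclideanSpace ℝ (Fin 3)} {J : (k : ℕ) → Fin (N k)}
    {a b δ : ℕ → ℝ} {n : ℕ → EuclideanSpace ℝ (Fin 3)} {C : ℕ → ℤ → ℝ}
    {L : (k : ℕ) → Fin (N k) → ℤ} {al bl ε : ℝ} {nl : EuclideanSpace ℝ (Fin 3)} {cl : ℤ → ℝ}
    (hW : ∀ k, 19 / 20 ≤ a k ∧ a k ≤ 1 ∧ 19 / 20 ≤ b k ∧ b k ≤ 1 ∧ ‖n k‖ = 1 ∧ C k 0 = 0 ∧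
      (∀ t : ℤ, C k t + 19 / 25 ≤ C k (t + 1)) ∧ L k (J k) = 0 ∧ 0 ≤ δ k ∧
      (∀ j : Fin (N k), dist (w k j) (w k (J k)) ≤ 2 →
        |inner ℝ (w k j - w k (J k)) (n k) - C k (L k j)| ≤ δ k) ∧
      (∀ j j' : Fin (N k), dist (w k j) (w k (J k)) ≤ 2 → dist (w k j') (w k (J k)) ≤ 2 →
        j ≠ j' → 19 / 20 ≤ dist (w k j) (w k j')) ∧
      ∀ j : Fin (N k), dist (w k j) (w k (J k)) ≤ 1 →
        Nat.card {k' : Fin (N k) // k' ≠ j ∧ L k k' = L k j ∧ dist (w k j) (w k k') ≤ 1} = 6 ∧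
        Nat.card {k' : Fin (N k) // L k k' = L k j + 1 ∧ dist (w k j) (w k k') ≤ 1} = 3 ∧
        Nat.card {k' : Fin (N k) // L k k' = L k j - 1 ∧ dist (w k j) (w k k') ≤ 1} = 3 ∧
        ∀ k' : Fin (N k), k' ≠ j → dist (w k j) (w k k') ≤ 1 →
          (L k k' = L k j → |dist (w k j) (w k k') - a k| ≤ δ k) ∧
          (L k k' ≠ L k j → |dist (w k j) (w k k') - b k| ≤ δ k))
    (hR2 : ∀ t ∈ X, dist t p ≤ 3 → ∀ s : ℤ, -3 ≤ s → s ≤ 3 →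
      |inner ℝ (t - p) nl - cl s| ≤ 10 * ε → inner ℝ (t - p) nl = cl s)
    (hε : ε ≤ 1 / 100)
    (hLate : ∀ᶠ k in atTop, δ k ≤ ε ∧ ‖n k - nl‖ ≤ ε ∧ |a k - al| ≤ ε ∧ |b k - bl| ≤ ε ∧
      (∀ s : ℤ, -3 ≤ s → s ≤ 3 → |C k s - cl s| ≤ ε) ∧ dist (w k (J k)) p ≤ δ k ∧
      ∀ j, dist (w k j) p ≤ 4 → ∃ x ∈ X, dist (w k j) x ≤ δ k)
    (hδ : Tendsto δ atTop (𝓝 0)) (hM1 : ∀ x ∈ X, ∀ᶠ k in atTop, ∃ j, dist (w k j) x ≤ δ k)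
    {x : EuclideanSpace ℝ (Fin 3)} (hx : x ∈ X) (hxp : dist x p < 2) :
    ∃ t : ℤ, inner ℝ (x - p) nl = cl t := by
  have hpos : 0 < (2 - dist x p) / 2 := by linarith
  obtain ⟨k, ⟨⟨hδε, hnn, -, -, hCc, hJp, -⟩, j, hj⟩, hsmall⟩ :=
    ((hLate.and (hM1 x hx)).and (hδ.eventually (eventually_lt_nhds hpos))).exists
  have hjJ : dist (w k j) (w k (J k)) ≤ 2 :=
    calc dist (w k j) (w k (J k)) ≤ dist (w k j) x + dist x p + dist p (w k (J k)) :=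
          dist_triangle4 _ _ _ _
      _ ≤ 2 := by rw [dist_comm p]; linarith
  exact ⟨L k j, (lf_label (hW k) hR2 hδε hε hnn hCc hJp hx hj hjJ).2.2⟩

/-- The first levels above and below `0` have heights `≥ 94/125` in absolute value (gaps
`≥ 19/25 = 95/125`). -/
theorem lf_abs_level_one :
    ∀ {c : ℤ → ℝ}, c 0 = 0 → (∀ t : ℤ, c t + 19 / 25 ≤ c (t + 1)) → 94 / 125 ≤ |c 1| ∧ 94 / 125 ≤ |c (-1)| := by
  intro cl hcl0 hclg
  have h1 := hclg 0
  rw [zero_add, hcl0] at h1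
  have h2 := hclg (-1)
  rw [show (-1 : ℤ) + 1 = 0 by norm_num, hcl0] at h2
  rw [abs_of_nonneg (by linarith), abs_of_nonpos (by linarith)]
  constructor <;> linarith

/-! ## The laminar kissing caps in the limit -/

/-- **Same-level cap in the limit.** Six points `t i` of `X \ {p}` within `1` of `p` at height `0`
(pairwise distinct) and a seventh such point `q ∉ {t i}` contradict
`LaminarKissingCap.no_seven_level` (norms in `[19/20, 1]`, pairwise `≥ 19/20`, heights `0`). -/
theorem lf_cap_level {X : Set (EuclideanSpace ℝ (Fin 3))}
    (hXsep : ∀ q ∈ X, ∀ r ∈ X, q ≠ r → (19 : ℝ) / 20 ≤ dist q r)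
    {p : EuclideanSpace ℝ (Fin 3)} (hp : p ∈ X) {nl : EuclideanSpace ℝ (Fin 3)} (hnl : ‖nl‖ = 1)
    (q : EuclideanSpace ℝ (Fin 3)) (t : Fin 6 → EuclideanSpace ℝ (Fin 3))
    (ht : Function.Injective t) (hqt : ∀ i, t i ≠ q)
    (hq : q ∈ X ∧ q ≠ p ∧ dist q p ≤ 1 ∧ inner ℝ (q - p) nl = 0)
    (hti : ∀ i, t i ∈ X ∧ t i ≠ p ∧ dist (t i) p ≤ 1 ∧ inner ℝ (t i - p) nl = 0) : False := by
  obtain ⟨v, hv0, hvs⟩ : ∃ v : Fin 7 → EuclideanSpace ℝ (Fin 3), v 0 = q ∧ ∀ i : Fin 6,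
      v i.succ = t i := ⟨Fin.cons q t, rfl, fun i => Fin.cons_succ _ _ _⟩
  have hP : ∀ i, v i ∈ X ∧ v i ≠ p ∧ dist (v i) p ≤ 1 ∧ inner ℝ (v i - p) nl = 0 := by
    intro i
    induction i using Fin.cases with
    | zero => rw [hv0]; exact hq
    | succ i => rw [hvs]; exact hti i
  have hinj : Function.Injective v := by
    intro i i' h
    induction i using Fin.cases with
    | zero =>
      induction i' using Fin.cases with
      | zero => rfl
      | succ i' => rw [hv0, hvs] at h; exact absurd h.symm (hqt i')
    | succ i =>
      induction i' using Fin.cases with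
      | zero => rw [hv0, hvs] at h; exact absurd h (hqt i)
      | succ i' => rw [hvs, hvs] at h; rw [ht h]
  refine LaminarKissingCap.no_seven_level hnl (fun i => v i - p) ?_ ?_ ?_ ?_ ?_
  · intro i
    rw [← dist_eq_norm]
    exact hXsep _ (hP i).1 _ hp (hP i).2.1
  · intro i
    rw [← dist_eq_norm]
    exact (hP i).2.2.1
  · intro i k hik
    rw [sub_sub_sub_cancel_right, ← dist_eq_norm]
    exact hXsep _ (hP i).1 _ (hP k).1 (hinj.ne hik)
  · intro i
    rw [(hP i).2.2.2, abs_zero]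
    norm_num
  · intro i k
    rw [(hP i).2.2.2, (hP k).2.2.2, sub_self, abs_zero]
    norm_num

/-- **Adjacent-level cap in the limit.** Three points `t i` of `X` within `1` of `p` at a common
height `h`, `|h| ≥ 94/125` (pairwise distinct), and a fourth such point `q ∉ {t i}` contradict
`LaminarKissingCap.no_four_adjacent`. -/
theorem lf_cap_adjacent {X : Set (EuclideanSpace ℝ (Fin 3))}
    (hXsep : ∀ q ∈ X, ∀ r ∈ X, q ≠ r → (19 : ℝ) / 20 ≤ dist q r)
    {p : EuclideanSpace ℝ (Fin 3)} {nl : EuclideanSpace ℝ (Fin 3)} (hnl : ‖nl‖ = 1) {h : ℝ}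
    (hh : 94 / 125 ≤ |h|) (q : EuclideanSpace ℝ (Fin 3)) (t : Fin 3 → EuclideanSpace ℝ (Fin 3))
    (ht : Function.Injective t) (hqt : ∀ i, t i ≠ q)
    (hq : q ∈ X ∧ dist q p ≤ 1 ∧ inner ℝ (q - p) nl = h)
    (hti : ∀ i, t i ∈ X ∧ dist (t i) p ≤ 1 ∧ inner ℝ (t i - p) nl = h) : False := by
  obtain ⟨v, hv0, hvs⟩ : ∃ v : Fin 4 → EuclideanSpace ℝ (Fin 3), v 0 = q ∧ ∀ i : Fin 3,
      v i.succ = t i := ⟨Fin.cons q t, rfl, fun i => Fin.cons_succ _ _ _⟩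
  have hP : ∀ i, v i ∈ X ∧ dist (v i) p ≤ 1 ∧ inner ℝ (v i - p) nl = h := by
    intro i
    induction i using Fin.cases with
    | zero => rw [hv0]; exact hq
    | succ i => rw [hvs]; exact hti i
  have hinj : Function.Injective v := by
    intro i i' h
    induction i using Fin.cases with
    | zero =>
      induction i' using Fin.cases with
      | zero => rfl
      | succ i' => rw [hv0, hvs] at h; exact absurd h.symm (hqt i')
    | succ i =>
      induction i' using Fin.cases with
      | zero => rw [hv0, hvs] at h; exact absurd h (hqt i)
      | succ i' => rw [hvs, hvs] at h; rw [ht h]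
  refine LaminarKissingCap.no_four_adjacent hnl (fun i => v i - p) ?_ ?_ ?_ ?_
  · intro i
    rw [← dist_eq_norm]
    exact (hP i).2.1
  · intro i k hik
    rw [sub_sub_sub_cancel_right, ← dist_eq_norm]
    exact hXsep _ (hP i).1 _ (hP k).1 (hinj.ne hik)
  · intro i
    rw [(hP i).2.2]
    exact hh
  · intro i k
    rw [(hP i).2.2, (hP k).2.2, sub_self, abs_zero]
    norm_num

end Summit.AtomisticToContinuum.Crystallization.Theorems.SquareWellLayerCake.StackingFaultSparsity.LocalFrames.Limit

end
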